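import Summits.HodgeConjecture.HodgeConjecture.Theorems.K2LiuSiegelDoubledCountReduction          -- ★ p09: smear, E3a, unfold chain
import Summits.HodgeConjecture.HodgeConjecture.Theorems.K2LiuSiegelEisensteinDoubledSummableReduction  -- ★ p09: `norm_apply_le_of_decomp`
import Summits.HodgeConjecture.HodgeConjecture.Theorems.K2LiuUnipotentCoveringWeight              -- ★ p06: compactly supported N_Δ(L⁺)-weight
import HarnessLib

/-!
# The Eisenstein majorant is bounded on compacta; discharge of the analytic binder (H) of O41.3 ∕ O41.4

Track B ∕ hLiu418 = stmt-HodgeConjecture-24832, line `K2_Liu_CurveThetaSigs`, unit U6 «FIRST TERM», socket #41, organ O41.3 «convergence of the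
Siegel intertwining operator» (LEAD F0P6-plan deal 2026-09-03T23:05:23Z to seat `hodgecm-mathlib-K2Liu-p06` (g0)), FILE (iii-b)+(iii-c); the
(M3) step of the prep memo `K2/K2Liu-p06/g0/PREP-O41_3-SiegelIntertwiningConvergence.v1.K2Liu-p06-g0.md`.

[MoeglinWaldspurger1995, II.1.6 Prop. (i), proof]: the intertwining integral is bounded by `∫_{U'(k)\U'(𝔸)} Σ_{γ ∈ P(k)\G(k)} |φ(γ u g)| du`, finite
«as `U'(k)\U'(𝔸)` is compact … as long as the series converge UNIFORMLY ON ALL COMPACT SETS». K2Liu-p09's ★ Godement chain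
(`K2LiuSiegelDoubledCountReduction.summable_height_rpow_of_lintegral_ne_top`: smear ∕ count ≤ integral ∕ bounded multiplicity E3a ∕ unfold E3b
∕ Siegel-domain integral E5) delivers the majorant `Σ_{γ ∈ P_Δ(L⁺)\H(L⁺)} Φ(γ h)^τ` POINTWISE in `h`; this file runs the SAME chain with the
compact `h·C` replaced by `K′·C` and obtains the bound UNIFORMLY for `h` in a compact `K′` (§1), transfers it to a continuous Siegel section
`f` of `I(s, χ)` (`|f(γ x)| ≤ (B∕c^τ)·Φ(γ x)^τ`, ★ `norm_apply_le_of_decomp`, `τ = 2 Re s + n`) (§2), and integrates it against a compactly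
supported `N_Δ(L⁺)`-covering weight `β` on `N_Δ(𝔸)` (★ `K2LiuUnipotentCoveringWeight`) to produce the analytic binder

  (H)  `∫⁻ u, (Σ'_q ‖f(γ_q · u · h)‖ₑ) · β u ∂νN ≠ ∞`

of K2Liu-p07's O41.4 «ORBIT FORM» and of O41.3 (§3), CONDITIONAL exactly on the two open organs it names as binders: the Siegel-domain
integral E5 (`hE5`, K2Liu-p09's stub E5′) and the cocompactness (C0) of `N_Δ(L⁺)` in `N_Δ(𝔸)` (`hcover`, organ E5′c).

Theorems only; axioms ⊆ {propext, Classical.choice, Quot.sound}.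

## References
* C. Moeglin, J.-L. Waldspurger, *Spectral decomposition and Eisenstein series* (1995), II.1.5, II.1.6 [MoeglinWaldspurger1995].
* P. Garrett, *Modern Analysis of Automorphic Forms by Example* (2018), §3.10 (proof of Cor. 3.10.2) [Garrett2018].

HONEST LABEL: HC_CM is proved only modulo the 7 printed citations (2 remaining named inputs: hLiu418 = stmt-HodgeConjecture-24832,
h413 = stmt-HodgeConjecture-24833) until rung 0 closes; this helper moves no counter.
-/

set_option autoImplicit false
set_option linter.dupNamespace false

noncomputable section

open scoped Matrix Pointwise ENNReal NNReal
open NumberField IsDedekindDomain MeasureTheory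

namespace Summit.HodgeConjecture.HodgeConjecture.Cruxes.HLiu418.K2LiuSiegelEisensteinMajorantLocallyBounded

open Literature.NumberTheory.Automorphic Literature.NumberTheory.Automorphic.UnitaryGroup
open Literature.NumberTheory.GaloisRepresentations
open Literature.NumberTheory.GelbartRogawski1991 Literature.NumberTheory.GelbartRogawski1991.GRConstruction
open Literature.NumberTheory.K2Lit.SiegelDoubled
open Literature.MeasureTheory.Group
open Summit.HodgeConjecture.HodgeConjecture.Cruxes.HLiu418.K2LiuSiegelDoubledHeightSmear
open Summit.HodgeConjecture.HodgeConjecture.Cruxes.HLiu418.K2LiuSiegelDoubledRationalMultiplicity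
open Summit.HodgeConjecture.HodgeConjecture.Cruxes.HLiu418.K2LiuSiegelDoubledCountVsIntegral
open Summit.HodgeConjecture.HodgeConjecture.Cruxes.HLiu418.K2LiuSiegelDoubledUnfold
open Summit.HodgeConjecture.HodgeConjecture.Cruxes.HLiu418.K2LiuSiegelDoubledCountReduction
open Summit.HodgeConjecture.HodgeConjecture.Cruxes.HLiu418.K2LiuSiegelCharacterTrivialOnRational
open Summit.HodgeConjecture.HodgeConjecture.Cruxes.HLiu418.K2LiuSiegelEisensteinDoubledSummableReduction
open Summit.HodgeConjecture.HodgeConjecture.Cruxes.HLiu418.K2LiuUnipotentCoveringWeight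

variable (L : Type) [Field L] [NumberField L] [IsCMField L]
variable {N M n : ℕ} (e : Fin N × Fin M ≃ Fin n)
  (dV : Fin N → L) (hdV : ∀ i, IsCMField.complexConj L (dV i) = dV i)
  (dW : Fin M → L) (hdW : ∀ i, IsCMField.complexConj L (dW i) = dW i)

variable [MeasurableSpace (HA L e dV hdV dW hdW)] [BorelSpace (HA L e dV hdV dW hdW)]

/-! ## §1 Godement's count, uniformly on compacta -/

/-- **GODEMENT'S COUNT IS BOUNDED ON COMPACTA.**  Under the hypotheses of ★ `summable_height_rpow_of_lintegral_ne_top` (left-invariant `μ`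
finite on compacta and positive on opens; Iwasawa compact `K₀`; a measurable height `Φ > 0` of type `(P_Δ, modDelta)` bounded below on compacta
with Godement's floor; `τ ≥ 0`; a `P_Δ(L⁺)`-weight `β'`; finiteness `hE5` of the Siegel-domain integrals) the sum `Σ_{γ ∈ P_Δ(L⁺)\H(L⁺)} Φ(γ x)^τ`
is bounded by ONE finite constant for all `x` in a compact `K′`: the pointwise chain with the smearing set `x·C ⊆ K′·C`.
[cite: MoeglinWaldspurger1995, II.1.5] [cite: Garrett2018, §3.10 (proof of Cor. 3.10.2)] -/
theorem tsum_ofReal_height_rpow_le_on_compact (μ : Measure (HA L e dV hdV dW hdW)) [μ.IsMulLeftInvariant]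
    [IsFiniteMeasureOnCompacts μ] [μ.IsOpenPosMeasure]
    {K₀ : Set (HA L e dV hdV dW hdW)} (hK₀ : IsCompact K₀)
    (hPK : ∀ x : HA L e dV hdV dW hdW, ∃ p k : HA L e dV hdV dW hdW, IsSiegelDelta L e dV hdV dW hdW p ∧ k ∈ K₀ ∧ x = p * k)
    {Φ : HA L e dV hdV dW hdW → ℝ} (hΦm : Measurable Φ) (hΦpos : ∀ x, 0 < Φ x)
    (hΦ : ∀ p x : HA L e dV hdV dW hdW, IsSiegelDelta L e dV hdV dW hdW p → Φ (p * x) = modDelta L e dV hdV dW hdW p * Φ x)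
    (hΦK : ∀ K : Set (HA L e dV hdV dW hdW), IsCompact K → ∃ c : ℝ, 0 < c ∧ ∀ k ∈ K, c ≤ Φ k)
    (hΦfloor : ∀ K : Set (HA L e dV hdV dW hdW), IsCompact K → ∃ C : ℝ, ∀ k ∈ K, ∀ γ : ratH L e dV hdV dW hdW,
      Φ ((γ : HA L e dV hdV dW hdW) * k) ≤ C)
    {τ : ℝ} (hτ : 0 ≤ τ)
    {β' : HA L e dV hdV dW hdW → ℝ≥0∞} (hβ' : IsCoveringWeight (↥(siegelDelta L e dV hdV dW hdW ⊓ ratH L e dV hdV dW hdW)) β')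
    (hE5 : ∀ C₀ : ℝ, ∫⁻ x, {x | Φ x ≤ C₀}.indicator (fun x => ENNReal.ofReal (Φ x ^ τ)) x * β' x ∂μ ≠ ∞)
    {K' : Set (HA L e dV hdV dW hdW)} (hK' : IsCompact K') :
    ∃ Cst : ℝ≥0∞, Cst ≠ ∞ ∧ ∀ x ∈ K', (∑' q : SiegelDeltaQuot L e dV hdV dW hdW,
      ENNReal.ofReal (Φ (((Quotient.out q : ratH L e dV hdV dW hdW) : HA L e dV hdV dW hdW) * x) ^ τ)) ≤ Cst := by
  classical
  haveI : Countable (ratH L e dV hdV dW hdW) := countable_ratH L e dV hdV dW hdW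
  haveI : Countable (SiegelDeltaQuot L e dV hdV dW hdW) := by unfold SiegelDeltaQuot; exact inferInstance
  -- a compact neighbourhood `C` of `1`, of positive finite measure
  obtain ⟨C, hCc, hC1⟩ := exists_compact_mem_nhds (1 : HA L e dV hdV dW hdW)
  have hCmeas : MeasurableSet C := hCc.measurableSet
  have hC0 : μ C ≠ 0 := by
    obtain ⟨U, hUC, hUo, h1U⟩ := mem_nhds_iff.1 hC1
    exact (lt_of_lt_of_le (hUo.measure_pos μ ⟨1, h1U⟩) (measure_mono hUC)).ne'
  have hCtop : μ C ≠ ∞ := hCc.measure_lt_top.ne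
  -- (a) smear
  obtain ⟨B, hB1, hB⟩ := exists_smear_const_rpow L e dV hdV dW hdW hK₀ hPK hΦpos hΦ hΦK
    (upper_bound_of_floor L e dV hdV dW hdW hΦfloor) hCc hτ
  have hB0 : 0 ≤ B := le_trans zero_le_one hB1
  -- the compact `D = K' · C` and the floor on it
  set D : Set (HA L e dV hdV dW hdW) := K' * C with hDdef
  have hDc : IsCompact D := hK'.mul hCc
  have hDmeas : MeasurableSet D := hDc.measurableSet
  obtain ⟨C₀, hC₀⟩ := hΦfloor D hDc
  set F : HA L e dV hdV dW hdW → ℝ≥0∞ := fun x => {x | Φ x ≤ C₀}.indicator (fun x => ENNReal.ofReal (Φ x ^ τ)) x with hFdef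
  have hFm : Measurable F := (hΦm.pow_const τ).ennreal_ofReal.indicator (measurableSet_le hΦm measurable_const)
  have hFinv : ∀ p ∈ siegelDelta L e dV hdV dW hdW ⊓ ratH L e dV hdV dW hdW, ∀ x : HA L e dV hdV dW hdW, F (p * x) = F x := by
    intro p hp x
    have hΦpx : Φ (p * x) = Φ x := by
      rw [hΦ p x (Subgroup.mem_inf.1 hp).1, modDelta_eq_one_of_mem_ratH (Subgroup.mem_inf.1 hp).2, one_mul]
    simp only [hFdef, Set.indicator_apply, Set.mem_setOf_eq, hΦpx]
  -- the translate sum `G`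
  set G : HA L e dV hdV dW hdW → ℝ≥0∞ := fun y => ∑' q : SiegelDeltaQuot L e dV hdV dW hdW,
    F ((((Quotient.out q : ratH L e dV hdV dW hdW) : HA L e dV hdV dW hdW)) * y) with hGdef
  have hGm : Measurable G := by
    show Measurable fun y => ∑' q : SiegelDeltaQuot L e dV hdV dW hdW,
      F ((((Quotient.out q : ratH L e dV hdV dW hdW) : HA L e dV hdV dW hdW)) * y)
    simp_rw [ENNReal.tsum_eq_iSup_sum]
    exact Measurable.iSup fun s => Finset.measurable_sum s fun q _ => hFm.comp (measurable_const_mul _)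
  have hGinv : ∀ γ : ratH L e dV hdV dW hdW, ∀ y, G (((γ : HA L e dV hdV dW hdW)) * y) = G y :=
    fun γ y => translateSum_ratH_mul L e dV hdV dW hdW hFinv γ y
  -- E3a on `D`, E3b, E5: the integral `I = ∫⁻ 1_D G` is finite
  obtain ⟨m, hm⟩ := exists_ncard_ratH_inter_mul_le L e dV hdV dW hdW hDc.inv
  obtain ⟨β, hβ⟩ := exists_isCoveringWeight_ratH L e dV hdV dW hdW
  have hE3a := lintegral_indicator_mul_le_of_invariant L e dV hdV dW hdW μ hGm hGinv hβ hDmeas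
    (fun y => finite_ratH_inter_mul L e dV hdV dW hdW hDc.inv y) hm
  have hE3b := lintegral_tsum_translate_mul_weight_eq L e dV hdV dW hdW μ hFm hFinv hβ hβ'
  set I : ℝ≥0∞ := ∫⁻ y, D.indicator (fun _ => (1 : ℝ≥0∞)) y * G y ∂μ with hIdef
  have hI : I ≠ ∞ := by
    refine ne_top_of_le_ne_top (ENNReal.mul_ne_top (ENNReal.natCast_ne_top m) ?_) hE3a
    rw [show (fun y => G y * β y) = fun y => (∑' q : SiegelDeltaQuot L e dV hdV dW hdW,
        F ((((Quotient.out q : ratH L e dV hdV dW hdW) : HA L e dV hdV dW hdW)) * y)) * β y from rfl, hE3b]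
    exact hE5 C₀
  refine ⟨ENNReal.ofReal B / μ C * I, ENNReal.mul_ne_top (ENNReal.div_ne_top ENNReal.ofReal_ne_top hC0) hI, fun x hx => ?_⟩
  -- E2: count ≤ integral at `x`
  have h1 := tsum_ofReal_le_mul_tsum_setLIntegral L e dV hdV dW hdW μ hCmeas hC0 hCtop (ψ := fun y => Φ y ^ τ) hB0
    (fun y c hc => (hB y c hc).1)
    (fun q : SiegelDeltaQuot L e dV hdV dW hdW => ((Quotient.out q : ratH L e dV hdV dW hdW) : HA L e dV hdV dW hdW) * x)
  refine h1.trans (mul_le_mul' le_rfl ?_)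
  -- `x • C ⊆ D`
  have hxC : x • C ⊆ D := Set.smul_set_subset_mul hx
  -- each term is an integral of `F` over `C` (translate + floor on `D`)
  have hterm : ∀ q : SiegelDeltaQuot L e dV hdV dW hdW,
      ∫⁻ y in ((((Quotient.out q : ratH L e dV hdV dW hdW) : HA L e dV hdV dW hdW)) * x) • C, ENNReal.ofReal (Φ y ^ τ) ∂μ =
        ∫⁻ c in C, F ((((Quotient.out q : ratH L e dV hdV dW hdW) : HA L e dV hdV dW hdW)) * (x * c)) ∂μ := by
    intro q
    rw [setLIntegral_translate_eq L e dV hdV dW hdW μ hCmeas _ _]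
    refine setLIntegral_congr_fun hCmeas fun c hc => ?_
    have hxcD : x * c ∈ D := Set.mul_mem_mul hx hc
    have hle : Φ ((((Quotient.out q : ratH L e dV hdV dW hdW) : HA L e dV hdV dW hdW)) * (x * c)) ≤ C₀ := hC₀ (x * c) hxcD _
    show ENNReal.ofReal (Φ (_ * c) ^ τ) = F _
    rw [mul_assoc, hFdef]
    dsimp only
    rw [Set.indicator_of_mem (show _ ∈ {x | Φ x ≤ C₀} from hle)]
  have hmeasq : ∀ q : SiegelDeltaQuot L e dV hdV dW hdW, Measurable fun c : HA L e dV hdV dW hdW =>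
      F ((((Quotient.out q : ratH L e dV hdV dW hdW) : HA L e dV hdV dW hdW)) * (x * c)) := fun q =>
    hFm.comp ((measurable_const_mul _).comp (measurable_const_mul _))
  calc (∑' q : SiegelDeltaQuot L e dV hdV dW hdW,
        ∫⁻ y in ((((Quotient.out q : ratH L e dV hdV dW hdW) : HA L e dV hdV dW hdW)) * x) • C, ENNReal.ofReal (Φ y ^ τ) ∂μ)
      = ∫⁻ c in C, G (x * c) ∂μ := by
        simp_rw [hterm]
        rw [← lintegral_tsum fun q => (hmeasq q).aemeasurable]
    _ = ∫⁻ y in x • C, G y ∂μ := (setLIntegral_translate_eq L e dV hdV dW hdW μ hCmeas G x).symm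
    _ ≤ ∫⁻ y in D, G y ∂μ := lintegral_mono_set hxC
    _ = I := by
        rw [hIdef, ← lintegral_indicator hDmeas]
        refine lintegral_congr fun y => ?_
        rw [← Set.indicator_mul_left _ (fun _ => (1 : ℝ≥0∞)) G]
        simp only [one_mul]

/-! ## §2 The Eisenstein majorant of a continuous section, uniformly on compacta -/

/-- **THE EISENSTEIN MAJORANT OF A CONTINUOUS SECTION IS BOUNDED ON COMPACTA.**  For a unitary `χ`, `τ = 2 Re s + n ≥ 0`, a continuous Siegel
section `f` of `I(s, χ)`, and the Godement data of §1 (with `hE5` at this `τ`): for every compact `K′ ⊆ H(𝔸)` there is a finite constant `C′`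
with `Σ_{γ ∈ P_Δ(L⁺)\H(L⁺)} ‖f(γ x)‖ₑ ≤ C′` for all `x ∈ K′` («the series converge uniformly on all compact sets» of the printed proof, in the
form the intertwining-operator bound consumes). [cite: MoeglinWaldspurger1995, II.1.5, II.1.6] [cite: Garrett2018, §3.10 (proof of Cor. 3.10.2)] -/
theorem tsum_enorm_translate_le_on_compact (μ : Measure (HA L e dV hdV dW hdW)) [μ.IsMulLeftInvariant]
    [IsFiniteMeasureOnCompacts μ] [μ.IsOpenPosMeasure]
    {χ : HeckeCharacter L} (hχ : χ.IsUnitary) {s : ℂ} (hτ : 0 ≤ 2 * s.re + (n : ℝ))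
    {f : HA L e dV hdV dW hdW → ℂ} (hf : IsSiegelDeltaSection L e dV hdV dW hdW χ s f) (hfc : Continuous f)
    {K₀ : Set (HA L e dV hdV dW hdW)} (hK₀ : IsCompact K₀)
    (hPK : ∀ x : HA L e dV hdV dW hdW, ∃ p k : HA L e dV hdV dW hdW, IsSiegelDelta L e dV hdV dW hdW p ∧ k ∈ K₀ ∧ x = p * k)
    {Φ : HA L e dV hdV dW hdW → ℝ} (hΦm : Measurable Φ) (hΦpos : ∀ x, 0 < Φ x)
    (hΦ : ∀ p x : HA L e dV hdV dW hdW, IsSiegelDelta L e dV hdV dW hdW p → Φ (p * x) = modDelta L e dV hdV dW hdW p * Φ x)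
    (hΦK : ∀ K : Set (HA L e dV hdV dW hdW), IsCompact K → ∃ c : ℝ, 0 < c ∧ ∀ k ∈ K, c ≤ Φ k)
    (hΦfloor : ∀ K : Set (HA L e dV hdV dW hdW), IsCompact K → ∃ C : ℝ, ∀ k ∈ K, ∀ γ : ratH L e dV hdV dW hdW,
      Φ ((γ : HA L e dV hdV dW hdW) * k) ≤ C)
    {β' : HA L e dV hdV dW hdW → ℝ≥0∞} (hβ' : IsCoveringWeight (↥(siegelDelta L e dV hdV dW hdW ⊓ ratH L e dV hdV dW hdW)) β')
    (hE5 : ∀ C₀ : ℝ, ∫⁻ x, {x | Φ x ≤ C₀}.indicator (fun x => ENNReal.ofReal (Φ x ^ (2 * s.re + (n : ℝ)))) x * β' x ∂μ ≠ ∞)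
    {K' : Set (HA L e dV hdV dW hdW)} (hK' : IsCompact K') :
    ∃ C' : ℝ≥0∞, C' ≠ ∞ ∧ ∀ x ∈ K', (∑' q : SiegelDeltaQuot L e dV hdV dW hdW,
      ‖f (((Quotient.out q : ratH L e dV hdV dW hdW) : HA L e dV hdV dW hdW) * x)‖ₑ) ≤ C' := by
  set τ : ℝ := 2 * s.re + (n : ℝ) with hτdef
  obtain ⟨Cst, hCst, hbound⟩ := tsum_ofReal_height_rpow_le_on_compact L e dV hdV dW hdW μ hK₀ hPK hΦm hΦpos hΦ hΦK hΦfloor hτ hβ'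
    hE5 hK'
  -- `‖f‖ ≤ B` on `K₀`, `Φ ≥ c > 0` on `K₀`
  obtain ⟨B, hB⟩ := hK₀.exists_bound_of_continuousOn hfc.continuousOn
  obtain ⟨c, hc, hcK⟩ := hΦK K₀ hK₀
  set A : ℝ := max B 0 / c ^ τ with hAdef
  have hA0 : 0 ≤ A := div_nonneg (le_max_right _ _) (Real.rpow_nonneg hc.le τ)
  have hB' : ∀ k ∈ K₀, ‖f k‖ ≤ max B 0 := fun k hk => (hB k hk).trans (le_max_left _ _)
  refine ⟨ENNReal.ofReal A * Cst, ENNReal.mul_ne_top ENNReal.ofReal_ne_top hCst, fun x hx => ?_⟩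
  have hpt : ∀ q : SiegelDeltaQuot L e dV hdV dW hdW,
      ‖f (((Quotient.out q : ratH L e dV hdV dW hdW) : HA L e dV hdV dW hdW) * x)‖ₑ ≤
        ENNReal.ofReal A * ENNReal.ofReal (Φ (((Quotient.out q : ratH L e dV hdV dW hdW) : HA L e dV hdV dW hdW) * x) ^ τ) := by
    intro q
    obtain ⟨p, k, hp, hk, hxpk⟩ := hPK (((Quotient.out q : ratH L e dV hdV dW hdW) : HA L e dV hdV dW hdW) * x)
    have hle := norm_apply_le_of_decomp L e dV hdV dW hdW hχ hτ hf hB' hΦpos hΦ hc hcK hp hk hxpk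
    rw [← ofReal_norm, ← ENNReal.ofReal_mul hA0]
    exact ENNReal.ofReal_le_ofReal hle
  calc (∑' q : SiegelDeltaQuot L e dV hdV dW hdW, ‖f (((Quotient.out q : ratH L e dV hdV dW hdW) : HA L e dV hdV dW hdW) * x)‖ₑ)
      ≤ ∑' q : SiegelDeltaQuot L e dV hdV dW hdW,
          ENNReal.ofReal A * ENNReal.ofReal (Φ (((Quotient.out q : ratH L e dV hdV dW hdW) : HA L e dV hdV dW hdW) * x) ^ τ) :=
        ENNReal.tsum_le_tsum hpt
    _ = ENNReal.ofReal A * ∑' q : SiegelDeltaQuot L e dV hdV dW hdW,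
          ENNReal.ofReal (Φ (((Quotient.out q : ratH L e dV hdV dW hdW) : HA L e dV hdV dW hdW) * x) ^ τ) := ENNReal.tsum_mul_left
    _ ≤ ENNReal.ofReal A * Cst := mul_le_mul' le_rfl (hbound x hx)

/-! ## §3 The analytic binder (H) of O41.3 ∕ O41.4 -/

/-- **DISCHARGE OF THE BINDER (H)** of the intertwining-operator convergence (O41.3) and of the constant-term orbit unfolding (O41.4, K2Liu-p07's
«ORBIT FORM»): given the Godement data of §2 and a compact `K ⊆ N_Δ(𝔸)` meeting every `N_Δ(L⁺)`-orbit (cocompactness (C0), organ E5′c), there is a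
compactly supported `N_Δ(L⁺)`-covering weight `β ≤ 1_K` on `N_Δ(𝔸)` (★ `K2LiuUnipotentCoveringWeight`) with
`∫⁻ u, (Σ'_q ‖f(γ_q · u · h)‖ₑ) · β u ∂νN < ∞` for every `h ∈ H(𝔸)` and every Haar `νN` on `N_Δ(𝔸)`: on the support of `β` the point
`u · h` stays in the compact `K · h`, where the majorant is bounded (§2), and `∫⁻ β dνN ≤ νN(K) < ∞`.  «As `U'(k)\U'(𝔸)` is compact … this term
is finite.» [cite: MoeglinWaldspurger1995, II.1.6 (proof of Prop. (i))] -/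
theorem exists_weight_lintegral_majorant_ne_top (μ : Measure (HA L e dV hdV dW hdW)) [μ.IsMulLeftInvariant]
    [IsFiniteMeasureOnCompacts μ] [μ.IsOpenPosMeasure]
    {χ : HeckeCharacter L} (hχ : χ.IsUnitary) {s : ℂ} (hτ : 0 ≤ 2 * s.re + (n : ℝ))
    {f : HA L e dV hdV dW hdW → ℂ} (hf : IsSiegelDeltaSection L e dV hdV dW hdW χ s f) (hfc : Continuous f)
    {K₀ : Set (HA L e dV hdV dW hdW)} (hK₀ : IsCompact K₀)
    (hPK : ∀ x : HA L e dV hdV dW hdW, ∃ p k : HA L e dV hdV dW hdW, IsSiegelDelta L e dV hdV dW hdW p ∧ k ∈ K₀ ∧ x = p * k)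
    {Φ : HA L e dV hdV dW hdW → ℝ} (hΦm : Measurable Φ) (hΦpos : ∀ x, 0 < Φ x)
    (hΦ : ∀ p x : HA L e dV hdV dW hdW, IsSiegelDelta L e dV hdV dW hdW p → Φ (p * x) = modDelta L e dV hdV dW hdW p * Φ x)
    (hΦK : ∀ K : Set (HA L e dV hdV dW hdW), IsCompact K → ∃ c : ℝ, 0 < c ∧ ∀ k ∈ K, c ≤ Φ k)
    (hΦfloor : ∀ K : Set (HA L e dV hdV dW hdW), IsCompact K → ∃ C : ℝ, ∀ k ∈ K, ∀ γ : ratH L e dV hdV dW hdW,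
      Φ ((γ : HA L e dV hdV dW hdW) * k) ≤ C)
    {β' : HA L e dV hdV dW hdW → ℝ≥0∞} (hβ' : IsCoveringWeight (↥(siegelDelta L e dV hdV dW hdW ⊓ ratH L e dV hdV dW hdW)) β')
    (hE5 : ∀ C₀ : ℝ, ∫⁻ x, {x | Φ x ≤ C₀}.indicator (fun x => ENNReal.ofReal (Φ x ^ (2 * s.re + (n : ℝ)))) x * β' x ∂μ ≠ ∞)
    [MeasurableSpace (unipDelta L e dV hdV dW hdW)] [BorelSpace (unipDelta L e dV hdV dW hdW)]
    (νN : Measure (unipDelta L e dV hdV dW hdW)) [νN.IsHaarMeasure]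
    {K : Set (unipDelta L e dV hdV dW hdW)} (hK : IsCompact K)
    (hcover : ∀ u : unipDelta L e dV hdV dW hdW, ∃ γ : unipDeltaRat L e dV hdV dW hdW, γ • u ∈ K)
    (h : HA L e dV hdV dW hdW) :
    ∃ β : unipDelta L e dV hdV dW hdW → ℝ≥0∞, IsCoveringWeight (unipDeltaRat L e dV hdV dW hdW) β ∧
      (∀ u, β u ≠ 0 → u ∈ K) ∧ (∀ u, β u ≤ K.indicator 1 u) ∧
      ∫⁻ u, (∑' q : SiegelDeltaQuot L e dV hdV dW hdW,
        ‖f (((Quotient.out q : ratH L e dV hdV dW hdW) : HA L e dV hdV dW hdW) * (u : HA L e dV hdV dW hdW) * h)‖ₑ) * β u ∂νN ≠ ∞ := by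
  obtain ⟨β, hβ, hsupp, hle, hβint⟩ :=
    exists_isCoveringWeight_unipDeltaRat_lintegral_ne_top L e dV hdV dW hdW νN hK hcover
  -- the compact `K · h ⊆ H(𝔸)` and the majorant bound on it
  set K' : Set (HA L e dV hdV dW hdW) := (fun u : unipDelta L e dV hdV dW hdW => (u : HA L e dV hdV dW hdW) * h) '' K with hK'def
  have hK' : IsCompact K' := hK.image (continuous_subtype_val.mul continuous_const)
  obtain ⟨C', hC', hbound⟩ := tsum_enorm_translate_le_on_compact L e dV hdV dW hdW μ hχ hτ hf hfc hK₀ hPK hΦm hΦpos hΦ hΦK hΦfloor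
    hβ' hE5 hK'
  refine ⟨β, hβ, hsupp, hle, ?_⟩
  -- pointwise: integrand ≤ C' · β u
  have hpt : ∀ u : unipDelta L e dV hdV dW hdW,
      (∑' q : SiegelDeltaQuot L e dV hdV dW hdW,
        ‖f (((Quotient.out q : ratH L e dV hdV dW hdW) : HA L e dV hdV dW hdW) * (u : HA L e dV hdV dW hdW) * h)‖ₑ) * β u ≤
        C' * β u := by
    intro u
    by_cases hu : β u = 0
    · rw [hu, mul_zero, mul_zero]
    · refine mul_le_mul' ?_ le_rfl
      have hmem : (u : HA L e dV hdV dW hdW) * h ∈ K' := ⟨u, hsupp u hu, rfl⟩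
      have hb := hbound ((u : HA L e dV hdV dW hdW) * h) hmem
      simp_rw [mul_assoc]
      exact hb
  refine ne_top_of_le_ne_top (ENNReal.mul_ne_top hC' hβint) ?_
  calc ∫⁻ u, (∑' q : SiegelDeltaQuot L e dV hdV dW hdW,
          ‖f (((Quotient.out q : ratH L e dV hdV dW hdW) : HA L e dV hdV dW hdW) * (u : HA L e dV hdV dW hdW) * h)‖ₑ) * β u ∂νN
      ≤ ∫⁻ u, C' * β u ∂νN := lintegral_mono hpt
    _ = C' * ∫⁻ u, β u ∂νN := lintegral_const_mul C' hβ.measurable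

end Summit.HodgeConjecture.HodgeConjecture.Cruxes.HLiu418.K2LiuSiegelEisensteinMajorantLocallyBounded

end
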